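import Literature.NumberTheory.EllipticCurves.SingularModuliWeberCubeRoot
import Literature.NumberTheory.EllipticCurves.WeberGamma3LevelFourRational
import HarnessLib

/-!
# `j − 1728` is a square in the field of singular moduli when `2` splits (`d_K ≡ 1 (mod 8)`)
# (Cox, *Primes of the form x² + ny²*, §12.B — Weber's `γ₃`, through `γ₃(2τ) ∈ ℚ(X₀(4))`)

Topic `NumberTheory/EllipticCurves` (complex multiplication).  One definition with body
(`weberFourValue τ = E₆(2τ)/η(2τ)¹² = γ₃(2τ)`), all statements proved, no named fact.  Companion of
`SingularModuliWeberCubeRoot.lean` (the cube root of `j`), with the same method at level `4`: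

* Step A (`apply_weberFourValue_heegnerTau_eq`): for a Heegner form `Q` of level `4` and
  discriminant `d_K` (these exist when `d_K ≡ 1 (mod 8)`: `exists_sq_sub_dvd_sixteen`) and
  `σ ∈ Aut(ℂ)` fixing `√d_K` and `j(τ_Q)`, `σ(γ₃(2τ_Q)) = γ₃(2τ_Q)`
  (`levelTransport_self_of_apply_formJ_eq`, `mapLaurent_weberFourFn`, `LevelTransport.apply_value_eq`);
* Step B (`weberFourValue_heegnerTau_mem_singularModuliField`): hence `γ₃(2τ_Q) ∈ H_K`;
* Step C (`weberFourValue_heegnerTau_sq`): `γ₃(2τ_Q)² = j(2τ_Q) − 1728 = j(τ_{(A/2, B, 2C)}) − 1728`;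
* Step D (`exists_mem_sq_eq_formJ_sub`): conjugation inside `Aut(ℂ)` to every singular modulus of
  discriminant `d_K`.

Classically (Cox Thm. 12.17, Weber/Birch/Schertz): for `2 ∤ D`, `√D·γ₃(τ₀)` generates the ring
class field; here only the maximal order with `2` split is treated, and only the consequence
"`j(τ_Q) − 1728` is a square in `H_K`" (so that the ideal `(j(τ_Q) − 1728)` is a square), which is
the second half of the complex-multiplication input (C) of
`Literature.Barriers.ABC.OWeakUniformABCImpliesNoSiegelZeros`.

## References

* D. A. Cox, *Primes of the form x² + ny²*, 2nd ed., 2013, §12.B, Thm. 12.17. [Cox2013]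
* G. Shimura, *Introduction to the arithmetic theory of automorphic functions*, 1971, §6.8,
  Thm. 6.31. [ShimuraIATAF1971]
-/

noncomputable section

open Complex Polynomial NumberField
open UpperHalfPlane hiding I
open scoped MatrixGroups ModularForm Cardinal IntermediateField

universe u

namespace Literature.NumberTheory.EllipticCurves

open ModularForms Literature.FieldTheory.AlgClosed
open Literature.NumberTheory.QuadraticFields.BinaryQuadraticForm
open Literature.NumberTheory.QuadraticFields.Quadratic (exists_sq_eq_discr discr_emod_four)

/-! ### Arithmetic preliminaries: `β² ≡ D (mod 16)`, the form `(A/2, B, 2C)` -/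

/-- `D ≡ 1 (mod 8)` makes `D` a square modulo `16` (so that Heegner forms of level `4` and
discriminant `D` exist). [folklore] -/
theorem exists_sq_sub_dvd_sixteen {D : ℤ} (h8 : D % 8 = 1) :
    ∃ β : ℤ, (4 * (4 : ℕ) : ℤ) ∣ β ^ 2 - D := by
  have key : ∀ d : ZMod 16, d.val % 8 = 1 → ∃ b : ZMod 16, b ^ 2 = d := by decide
  have hmod : ((D : ZMod 16)).val = (D % 16).toNat := by
    have h := ZMod.val_intCast (n := 16) D
    have h0 : 0 ≤ D % 16 := Int.emod_nonneg D (by norm_num)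
    have : ((D : ZMod 16).val : ℤ) = D % 16 := h
    omega
  have hD8 : ((D : ZMod 16)).val % 8 = 1 := by rw [hmod]; omega
  obtain ⟨b, hb⟩ := key (D : ZMod 16) hD8
  refine ⟨(b.val : ℤ), ?_⟩
  have h16 : ((((b.val : ℤ) ^ 2 - D : ℤ)) : ZMod 16) = 0 := by
    push_cast
    rw [ZMod.natCast_zmod_val, hb, sub_self]
  have := (ZMod.intCast_zmod_eq_zero_iff_dvd _ 16).mp h16
  norm_num
  exact this

/-- For `Q = (A, B, C)` with `2 ∣ A`, the Heegner point of `(A/2, B, 2C)` is `2τ_Q`. [folklore] -/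
theorem heegnerTau_divTwo {A B C : ℤ} (hA : 0 < A) (h2 : (2 : ℤ) ∣ A)
    (hdisc : B ^ 2 - 4 * A * C < 0) :
    heegnerTau (A / 2, B, 2 * C) = tpD 2 • heegnerTau (A, B, C) := by
  obtain ⟨a, rfl⟩ := h2
  have ha : 0 < a := by omega
  have hdiv : (2 * a) / 2 = a := by omega
  have hdisc' : B ^ 2 - 4 * a * (2 * C) < 0 := by nlinarith
  apply UpperHalfPlane.ext
  rw [coe_tpD_smul, show ((2 * a) / 2 : ℤ) = a from hdiv]
  rw [coe_heegnerTau (Q := (a, B, 2 * C)) ha hdisc', coe_heegnerTau (Q := (2 * a, B, C)) (by omega) hdisc]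
  apply Complex.ext
  · simp; field_simp
  · simp only [Complex.mul_im]
    norm_num
    have h1 : (4 * (a : ℝ) * (2 * C) - B ^ 2) = (4 * (2 * a) * C - B ^ 2) := by ring
    rw [h1]
    field_simp

/-- `(A/2, B, 2C)` is primitive when `(A, B, C)` is, `2 ∣ A` and `2 ∤ B² − 4AC`. [folklore] -/
theorem isPrimitive_divTwo {A B C : ℤ} (h2 : (2 : ℤ) ∣ A)
    (hprim : ∀ d : ℤ, d ∣ A → d ∣ B → d ∣ C → IsUnit d) (hD : ¬ (2 : ℤ) ∣ B ^ 2 - 4 * A * C) :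
    ∀ d : ℤ, d ∣ A / 2 → d ∣ B → d ∣ 2 * C → IsUnit d := by
  obtain ⟨a, rfl⟩ := h2
  have hdiv : (2 * a) / 2 = a := by omega
  rw [hdiv]
  intro d hda hdB hdC
  have h2d : ¬ (2 : ℤ) ∣ d := by
    intro h
    apply hD
    obtain ⟨b', hb'⟩ := dvd_trans h hdB
    rw [hb']
    exact ⟨2 * b' ^ 2 - 4 * a * C, by ring⟩
  have hcop : IsCoprime d 2 := ((Int.prime_two.coprime_iff_not_dvd).mpr h2d).symm
  have hdC' : d ∣ C := hcop.dvd_of_dvd_mul_left hdC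
  exact hprim d (dvd_trans hda (Dvd.intro_left 2 rfl)) hdB hdC'

/-! ### The value `γ₃(2τ) = E₆(2τ)/η(2τ)¹²` -/

/-- The value of Weber's `γ₃` at `2τ`, `E₆(2τ)/η(2τ)¹²` — the value of `γ₃(2τ) ∈ K_4` at `τ`
(`pointValuation_weberFourFn_sub_lt_one`). [cite: Cox2013, §12.B] -/
def weberFourValue (τ : ℍ) : ℂ :=
  ModularForm.E₆ (tpD 2 • τ) / ModularForm.eta (2 * (τ : ℂ)) ^ 12

/-- **`γ₃(2τ)² = j(2τ) − 1728`** (`E₄³ − E₆² = 1728Δ`). [cite: Cox2013, §12.B] -/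
theorem weberFourValue_sq (τ : ℍ) : weberFourValue τ ^ 2 = kleinJ (tpD 2 • τ) - 1728 := by
  have hΔ := ModularForm.discriminant_ne_zero (tpD 2 • τ)
  have hΔη : ModularForm.discriminant (tpD 2 • τ) = ModularForm.eta (2 * (τ : ℂ)) ^ 24 := by
    rw [ModularForm.discriminant, coe_tpD_smul]; push_cast; ring_nf
  have h1728 : ModularForm.discriminant (tpD 2 • τ) * 1728 =
      ModularForm.E₄ (tpD 2 • τ) ^ 3 - ModularForm.E₆ (tpD 2 • τ) ^ 2 := by
    rw [ModularForm.discriminant_eq_E₄_cube_sub_E₆_sq]; ring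
  have hsq : weberFourValue τ ^ 2 =
      ModularForm.E₆ (tpD 2 • τ) ^ 2 / ModularForm.discriminant (tpD 2 • τ) := by
    rw [weberFourValue, div_pow, ← pow_mul, show 12 * 2 = 24 by norm_num, ← hΔη]
  rw [hsq, kleinJ, eq_sub_iff_add_eq, div_add' _ _ _ hΔ, div_eq_div_iff hΔ hΔ]
  linear_combination (ModularForm.discriminant (tpD 2 • τ)) * h1728

/-! ### Steps A–B: `γ₃(2τ_Q)` lies in the field of singular moduli -/

variable {K : Type u} [Field K] [NumberField K]

/-- `gcd(4, d_K) = 1` when `d_K ≡ 1 (mod 8)`. [folklore] -/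
theorem isCoprime_four_discr (h8 : NumberField.discr K % 8 = 1) :
    IsCoprime ((4 : ℕ) : ℤ) (NumberField.discr K) := by
  have h : IsCoprime (2 : ℤ) (NumberField.discr K) := by
    rw [Int.prime_two.coprime_iff_not_dvd]
    omega
  simpa using h.pow_left (m := 2)

/-- **Step A**: an automorphism of `ℂ` fixing `√d_K` and `j(τ_Q)`, `Q` a Heegner form of level `4` and
discriminant `d_K ≡ 1 (mod 8)`, fixes `γ₃(2τ_Q)`. [cite: Cox2013, §12.B Thm. 12.17] [cite: ShimuraIATAF1971, §6.8 and Thm. 6.31] -/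
theorem apply_weberFourValue_heegnerTau_eq (hK : IsImaginaryQuadratic K)
    (h8 : NumberField.discr K % 8 = 1) {β : ℤ}
    (hβD : (4 * (4 : ℕ) : ℤ) ∣ β ^ 2 - NumberField.discr K) {σ : ℂ ≃+* ℂ}
    (hσ : σ (sqrtDisc (NumberField.discr K)) = sqrtDisc (NumberField.discr K))
    {Q : ℤ × ℤ × ℤ} (hQ : Q ∈ heegnerForms 4 (NumberField.discr K))
    (hβ : Q.2.1 ≡ β [ZMOD 2 * (4 : ℕ)]) (hj : σ (formJ Q) = formJ Q) :
    σ (weberFourValue (heegnerTau Q)) = weberFourValue (heegnerTau Q) := by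
  have hT := levelTransport_self_of_apply_formJ_eq hK.discr_neg (isCoprime_four_discr h8) hβD hσ
    hQ hβ hj
  exact LevelTransport.apply_value_eq (N := 4) hT (mapLaurent_weberFourFn (σ : ℂ →+* ℂ))
    (pointValuation_weberFourFn_sub_lt_one (heegnerTau Q))

/-- **Step B: `γ₃(2τ_Q) ∈ H_K`.** [cite: Cox2013, §12.B Thm. 12.17] -/
theorem weberFourValue_heegnerTau_mem_singularModuliField (hK : IsImaginaryQuadratic K)
    (h8 : NumberField.discr K % 8 = 1) (ι : K →+* ℂ) {β : ℤ}
    (hβD : (4 * (4 : ℕ) : ℤ) ∣ β ^ 2 - NumberField.discr K)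
    {Q : ℤ × ℤ × ℤ} (hQ : Q ∈ heegnerForms 4 (NumberField.discr K))
    (hβ : Q.2.1 ≡ β [ZMOD 2 * (4 : ℕ)]) :
    weberFourValue (heegnerTau Q) ∈ singularModuliField K ι := by
  refine Complex.mem_subfield_of_forall_ringEquiv _ (cardinalMk_singularModuliField_le K hK ι) ?_
  intro σ hσ
  have hσD : σ (sqrtDisc (NumberField.discr K)) = sqrtDisc (NumberField.discr K) :=
    apply_sqrtDisc_discr_eq hK ι fun x ↦ hσ _ (apply_mem_singularModuliField ι x)
  have hjmem : kleinJ (heegnerTau Q) ∈ singularModuliField K ι :=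
    kleinJ_heegnerTau_mem_singularModuliField hK ι hQ
  have hj : σ (formJ Q) = formJ Q := by
    rw [formJ_def, ← kleinJ_eq_periodPair_j]
    exact hσ _ hjmem
  exact apply_weberFourValue_heegnerTau_eq hK h8 hβD hσD hQ hβ hj

/-! ### Step C: `γ₃(2τ_Q)² = j(τ_{(A/2, B, 2C)}) − 1728` -/

/-- **`γ₃(2τ_Q)² = j(τ_{(A/2, B, 2C)}) − 1728`.** [folklore] -/
theorem weberFourValue_heegnerTau_sq {D : ℤ} (hD : D < 0) {Q : ℤ × ℤ × ℤ}
    (hQ : Q ∈ heegnerForms 4 D) :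
    weberFourValue (heegnerTau Q) ^ 2 = formJ (Q.1 / 2, Q.2.1, 2 * Q.2.2) - 1728 := by
  obtain ⟨hdisc, hA, hNA, -⟩ := hQ
  have h2A : (2 : ℤ) ∣ Q.1 := dvd_trans (by norm_num) hNA
  rw [weberFourValue_sq, formJ_def, ← kleinJ_eq_periodPair_j]
  congr 2
  obtain ⟨A, B, C⟩ := Q
  exact (heegnerTau_divTwo hA h2A (by simp only at hdisc; rw [hdisc]; exact hD)).symm

/-- The form `(A/2, B, 2C)` attached to a Heegner form of level `4` and odd discriminant `D` is
primitive and positive definite of discriminant `D`. [folklore] -/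
theorem divTwo_spec {D : ℤ} (h8 : D % 8 = 1) {Q : ℤ × ℤ × ℤ} (hQ : Q ∈ heegnerForms 4 D) :
    0 < Q.1 / 2 ∧ IsPrimitive (Q.1 / 2, Q.2.1, 2 * Q.2.2) ∧ discr (Q.1 / 2, Q.2.1, 2 * Q.2.2) = D := by
  obtain ⟨hdisc, hA, hNA, hprim⟩ := hQ
  have h2A : (2 : ℤ) ∣ Q.1 := dvd_trans (by norm_num) hNA
  obtain ⟨a, ha⟩ := h2A
  refine ⟨by omega, ?_, ?_⟩
  · rw [isPrimitive_iff_binQF, _root_.Literature.NumberTheory.QuadraticFields.Quadratic.BinQF.isPrimitive_iff]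
    have hD2 : ¬ (2 : ℤ) ∣ Q.2.1 ^ 2 - 4 * Q.1 * Q.2.2 := by rw [hdisc]; omega
    exact isPrimitive_divTwo ⟨a, ha⟩ hprim hD2
  · rw [QuadraticFields.BinaryQuadraticForm.discr_apply, ← hdisc, ha]
    have : (2 * a) / 2 = a := by omega
    rw [this]; ring

/-! ### Step D and the theorem -/

/-- **From one square root to all**: if `j(τ_{Q₁}) − 1728 = w₀²` with `w₀ ∈ H_K` for one primitive form
`Q₁` of discriminant `d_K`, then the same holds for every such form `Q₀`. [cite: Cox2013, §13.A Prop. 13.2 (conjugacy of singular moduli)] -/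
theorem exists_mem_sq_eq_formJ_sub_of_one (hK : IsImaginaryQuadratic K) (ι : K →+* ℂ)
    {Q₁ Q₀ : ℤ × ℤ × ℤ} (hA₁ : 0 < Q₁.1) (hprim₁ : IsPrimitive Q₁) (hdisc₁ : discr Q₁ = NumberField.discr K)
    (hA₀ : 0 < Q₀.1) (hprim₀ : IsPrimitive Q₀) (hdisc₀ : discr Q₀ = NumberField.discr K)
    {w₀ : ℂ} (hw₀ : w₀ ∈ singularModuliField K ι) (hsq : w₀ ^ 2 = formJ Q₁ - 1728) :
    ∃ w ∈ singularModuliField K ι, w ^ 2 = formJ Q₀ - 1728 := by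
  set D := NumberField.discr K with hDdef
  have hD : D < 0 := hK.discr_neg
  have hSint := isIntegral_rat_of_mem_image_formJ hD
  set j₁ := formJ Q₁ with hj₁
  set j₀ := formJ Q₀ with hj₀
  have hmin : minpoly ℚ j₁ = minpoly ℚ j₀ := by
    rw [hj₁, hj₀, minpoly_formJ_eq_principalForm hD hSint hA₁ hprim₁ hdisc₁,
      minpoly_formJ_eq_principalForm hD hSint hA₀ hprim₀ hdisc₀]
  have hint₁ : IsIntegral ℚ j₁ := (isIntegral_int_formJ hA₁ hprim₁ (by rw [hdisc₁]; exact hD)).tower_top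
  have hint₀ : IsIntegral ℚ j₀ := (isIntegral_int_formJ hA₀ hprim₀ (by rw [hdisc₀]; exact hD)).tower_top
  have hroot : j₀ ∈ (minpoly ℚ j₁).aroots ℂ := by
    rw [Polynomial.mem_aroots, hmin]
    exact ⟨minpoly.ne_zero hint₀, minpoly.aeval ℚ j₀⟩
  set φ : ℚ⟮j₁⟯ →ₐ[ℚ] ℂ := (IntermediateField.algHomAdjoinIntegralEquiv ℚ hint₁).symm ⟨j₀, hroot⟩ with hφ
  have hφj : φ (IntermediateField.AdjoinSimple.gen ℚ j₁) = j₀ :=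
    IntermediateField.algHomAdjoinIntegralEquiv_symm_apply_gen ℚ hint₁ ⟨j₀, hroot⟩
  haveI : FiniteDimensional ℚ ℚ⟮j₁⟯ := IntermediateField.adjoin.finiteDimensional hint₁
  have hcount : #(ℚ⟮j₁⟯.toSubfield) ≤ ℵ₀ :=
    Subfield.cardinalMk_le_aleph0_of_isAlgebraic ℚ⟮j₁⟯.toSubfield
  obtain ⟨σ, hσ⟩ := Complex.exists_ringEquiv_apply_eq_of_subfield ℚ⟮j₁⟯.toSubfield hcount φ.toRingHom
  have hσj : σ j₁ = j₀ := by
    have := hσ ⟨j₁, IntermediateField.mem_adjoin_simple_self ℚ j₁⟩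
    rw [← hφj]
    exact this
  refine ⟨σ w₀, ringEquiv_apply_mem_singularModuliField hK ι σ hw₀, ?_⟩
  rw [← map_pow, hsq, map_sub, map_ofNat, hσj]

/-- **`j(τ_Q) − 1728` is a square in `H_K` when `d_K ≡ 1 (mod 8)`** (Weber's `γ₃`, maximal order,
`2` split): for every primitive positive definite form `Q₀` of discriminant `d_K` there is
`w ∈ H_K = singularModuliField K ι` with `w² = j(τ_{Q₀}) − 1728`. [cite: Cox2013, §12.B Thm. 12.17] -/
theorem exists_mem_singularModuliField_sq_eq_formJ_sub (hK : IsImaginaryQuadratic K)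
    (h8 : NumberField.discr K % 8 = 1) (ι : K →+* ℂ) {Q₀ : ℤ × ℤ × ℤ} (hA₀ : 0 < Q₀.1)
    (hprim₀ : IsPrimitive Q₀) (hdisc₀ : discr Q₀ = NumberField.discr K) :
    ∃ w ∈ singularModuliField K ι, w ^ 2 = formJ Q₀ - 1728 := by
  set D := NumberField.discr K with hDdef
  have hD : D < 0 := hK.discr_neg
  have h4 : D % 4 = 0 ∨ D % 4 = 1 := discr_emod_four hK.1
  obtain ⟨β, hβD⟩ := exists_sq_sub_dvd_sixteen h8
  have hP1 : 0 < (principalForm D).1 := by rw [principalForm_fst]; exact one_pos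
  obtain ⟨Q, hQ, hβ, -⟩ := exists_heegnerForm_formJ_eq hK (N := 4) hβD hP1
    (isPrimitive_principalForm D) (discr_principalForm h4)
  have hmem := weberFourValue_heegnerTau_mem_singularModuliField hK h8 ι hβD hQ hβ
  have hsq := weberFourValue_heegnerTau_sq hD hQ
  obtain ⟨hA'', hprim'', hdisc''⟩ := divTwo_spec h8 hQ
  exact exists_mem_sq_eq_formJ_sub_of_one hK ι hA'' hprim'' hdisc'' hA₀ hprim₀ hdisc₀ hmem hsq

/-- **The ideal form**: in `𝓞 H_K`, the principal ideal `(j(τ_{Q₀}) − 1728)` is the square of a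
principal ideal, for `d_K ≡ 1 (mod 8)`. [cite: Cox2013, §12.B Thm. 12.17 (consequence)] -/
theorem exists_span_formJ_sub_eq_sq (hK : IsImaginaryQuadratic K)
    (h8 : NumberField.discr K % 8 = 1) (ι : K →+* ℂ) {Q₀ : ℤ × ℤ × ℤ} (hA₀ : 0 < Q₀.1)
    (hprim₀ : IsPrimitive Q₀) (hdisc₀ : discr Q₀ = NumberField.discr K)
    (j₀ : 𝓞 (singularModuliField K ι)) (hj₀ : ((j₀ : singularModuliField K ι) : ℂ) = formJ Q₀) :
    ∃ w : 𝓞 (singularModuliField K ι), Ideal.span {j₀ - 1728} = Ideal.span {w} ^ 2 := by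
  obtain ⟨w, hwmem, hw2⟩ := exists_mem_singularModuliField_sq_eq_formJ_sub hK h8 ι hA₀ hprim₀ hdisc₀
  have hD : NumberField.discr K < 0 := hK.discr_neg
  have h1728 : IsIntegral ℤ (1728 : ℂ) := by
    have h := isIntegral_algebraMap (R := ℤ) (A := ℂ) (x := 1728)
    simpa using h
  have hjint : IsIntegral ℤ (formJ Q₀ - 1728) :=
    (isIntegral_int_formJ hA₀ hprim₀ (by rw [hdisc₀]; exact hD)).sub h1728
  have hwint : IsIntegral ℤ w := IsIntegral.of_pow (by norm_num : 0 < 2) (by rw [hw2]; exact hjint)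
  have hwintF : IsIntegral ℤ (⟨w, hwmem⟩ : singularModuliField K ι) :=
    (isIntegral_algHom_iff (singularModuliField K ι).subtype.toIntAlgHom Subtype.val_injective).mp hwint
  have hjF : (j₀ : singularModuliField K ι) - 1728 = (⟨w, hwmem⟩ : singularModuliField K ι) ^ 2 := by
    apply Subtype.ext
    rw [SubmonoidClass.coe_pow, hw2, ← hj₀]
    rfl
  have hj : j₀ - 1728 = ⟨⟨w, hwmem⟩, hwintF⟩ ^ 2 := by
    apply NumberField.RingOfIntegers.ext
    rw [RingOfIntegers.coe_eq_algebraMap, RingOfIntegers.coe_eq_algebraMap, map_sub, map_ofNat,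
      map_pow, RingOfIntegers.map_mk]
    exact hjF
  exact ⟨⟨⟨w, hwmem⟩, hwintF⟩, by rw [hj, Ideal.span_singleton_pow]⟩

end Literature.NumberTheory.EllipticCurves

end
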